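import Mathlib
import HarnessLib

/-!
# The multilinear coefficient of a product of linear forms is the permanent

Topic `Literature/Combinatorics/Enumerative`.  For a square matrix `A = (A i j)` over a
commutative semiring `R`, indexed by a finite type `ι`, consider the product of its ROW FORMS

  `p_A(z) := ∏_i (∑_j A i j · z_j) ∈ R[z_j : j ∈ ι]`   (`MvPolynomial ι R`).

The coefficient of the square-free monomial `∏_j z_j` (exponent vector `∑_j e_j`, i.e. `1` at
every coordinate) in `p_A` is the PERMANENT of `A`:

  `coeff_{∏_j z_j} p_A = per A = ∑_{σ ∈ Sym ι} ∏_i A i (σ i)`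
  (**`coeff_prod_rowForms_eq_permanent`**),

equivalently the mixed partial derivative `∂^ι p_A / ∂z` is the constant `per A`.  This is the
starting identity of Gurvits' capacity proof of the van der Waerden / Schrijver–Valiant
permanent bounds ([Gurvits2008, §4]: `per A = ∂ⁿ p_A / ∂z_1 ⋯ ∂z_n`, and `p_A` is real stable of
capacity one when `A` is doubly stochastic); only the (purely algebraic) coefficient identity is
proved here.

Proof.  Expand the product of sums over all maps `g : ι → ι` (`Finset.prod_univ_sum`); the
`g`-term is the monomial `(∏_i A i (g i)) · z^{∑_i e_{g i}}` (`prod_C_mul_X_eq_monomial`), and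
`∑_i e_{g i} = ∑_j e_j` holds iff every fibre of `g` is a singleton iff `g` is a bijection
(`sum_single_one_comp_eq_iff_bijective`).  Re-indexing the surviving terms by `Equiv.Perm ι`
gives `∑_σ ∏_i A i (σ i) = per Aᵀ = per A` (`Matrix.permanent_transpose`).  The empty matrix is
covered (`coeff_1 1 = 1 = per`).

Contents: `prod_C_mul_X_eq_monomial`, `sum_single_one_comp_eq_iff_bijective`,
`sum_perm_prod_apply_eq_permanent` (the row-indexed expansion `∑_σ ∏_i A i (σ i) = per A`),
`coeff_prod_rowForms_eq_permanent`, `coeff_prod_colForms_eq_permanent` (column forms), and the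
`Fin n` / `ℝ` specialisation `coeff_prod_rowForms_eq_permanent_fin` consumed by the
`ValiantsHypothesis` tree.  Deliberately NOT here: stability / capacity of `p_A`, Gurvits'
inequality, anything analytic.

## References

* [folklore]; context: [Gurvits2008] L. Gurvits, *Van der Waerden/Schrijver–Valiant like
  conjectures and stable (aka hyperbolic) homogeneous polynomials: one theorem for all*,
  Electron. J. Combin. 15 (2008), R66, §4.
-/

namespace Literature.Combinatorics.Enumerative

open MvPolynomial Finset

variable {ι : Type*} [Fintype ι] {R : Type*} [CommSemiring R]

/-- A product of scaled variables is a monomial: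
`∏_{i ∈ s} (a i) · z_{g i} = (∏_{i ∈ s} a i) · z^{∑_{i ∈ s} e_{g i}}`. [folklore] -/
theorem prod_C_mul_X_eq_monomial {α σ : Type*} (s : Finset α) (a : α → R) (g : α → σ) :
    (∏ i ∈ s, C (a i) * X (g i) : MvPolynomial σ R) =
      monomial (∑ i ∈ s, Finsupp.single (g i) 1) (∏ i ∈ s, a i) := by
  simp_rw [C_mul_X_eq_monomial]
  exact (monomial_sum_prod _ _ _).symm

/-- **Fibre count.**  For a map `g : ι → κ` of finite types, the exponent vectors `∑_i e_{g i}`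
and `∑_j e_j` (in `κ →₀ ℕ`) agree iff `g` is a bijection: the `j`-th coordinate of the left side
is the size of the fibre `g⁻¹(j)`, of the right side `1`. [folklore] -/
theorem sum_single_one_comp_eq_iff_bijective {κ : Type*} [Fintype κ] (g : ι → κ) :
    (∑ i, Finsupp.single (g i) (1 : ℕ)) = ∑ j, Finsupp.single j 1 ↔ Function.Bijective g := by
  classical
  constructor
  · intro h
    have hfib : ∀ j, (∑ i, if g i = j then (1 : ℕ) else 0) = 1 := by
      intro j
      have := DFunLike.congr_fun h j
      simpa only [Finsupp.coe_finsetSum, Finset.sum_apply, Finsupp.single_apply,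
        Finset.sum_ite_eq', Finset.mem_univ, if_true] using this
    refine ⟨?_, ?_⟩
    · intro a b hab
      by_contra hne
      have h2 : (2 : ℕ) ≤ ∑ i, if g i = g a then (1 : ℕ) else 0 :=
        calc (2 : ℕ) = ∑ i ∈ ({a, b} : Finset ι), if g i = g a then (1 : ℕ) else 0 := by
              rw [Finset.sum_pair hne]; simp [hab]
          _ ≤ ∑ i, if g i = g a then (1 : ℕ) else 0 :=
              Finset.sum_le_sum_of_subset (Finset.subset_univ _)
      rw [hfib (g a)] at h2
      omega
    · intro j
      by_contra hj
      push Not at hj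
      have h0 : (∑ i, if g i = j then (1 : ℕ) else 0) = 0 :=
        Finset.sum_eq_zero fun i _ => if_neg (hj i)
      rw [hfib j] at h0
      exact one_ne_zero h0
  · intro hg
    exact hg.sum_comp (fun j => Finsupp.single j 1)

variable [DecidableEq ι]

/-- The row-indexed expansion of the permanent: `∑_σ ∏_i A i (σ i) = per A`.  (Mathlib's
`Matrix.permanent A` is the column-indexed sum `∑_σ ∏_i A (σ i) i`; the two agree by
`Matrix.permanent_transpose`.) [folklore] -/
theorem sum_perm_prod_apply_eq_permanent (A : Matrix ι ι R) :
    ∑ σ : Equiv.Perm ι, ∏ i, A i (σ i) = A.permanent := by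
  rw [← Matrix.permanent_transpose]
  rfl

/-- **The multilinear coefficient of the product of the row forms is the permanent.**  For every
square matrix `A` over a commutative semiring,
`coeff_{∏_j z_j} (∏_i ∑_j A i j · z_j) = per A`; no hypothesis on `A`. [folklore] -/
theorem coeff_prod_rowForms_eq_permanent (A : Matrix ι ι R) :
    MvPolynomial.coeff (∑ j : ι, Finsupp.single j 1)
      (∏ i : ι, ∑ j : ι, C (A i j) * X j : MvPolynomial ι R) = A.permanent := by
  rw [Finset.prod_univ_sum, Fintype.piFinset_univ, MvPolynomial.coeff_sum]
  simp_rw [prod_C_mul_X_eq_monomial, MvPolynomial.coeff_monomial]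
  rw [← Finset.sum_filter, ← sum_perm_prod_apply_eq_permanent]
  symm
  refine Finset.sum_nbij (fun σ => ⇑σ) ?_ ?_ ?_ ?_
  · intro σ _
    simp only [Finset.mem_filter, Finset.mem_univ, true_and]
    exact (sum_single_one_comp_eq_iff_bijective _).mpr σ.bijective
  · exact fun σ _ τ _ h => Equiv.coe_fn_injective h
  · intro g hg
    simp only [Finset.coe_filter, Finset.mem_univ, true_and, Set.mem_setOf_eq] at hg
    exact ⟨Equiv.ofBijective g ((sum_single_one_comp_eq_iff_bijective g).mp hg), by simp, rfl⟩
  · intro σ _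
    rfl

/-- Column-form variant: `coeff_{∏_i z_i} (∏_j ∑_i A i j · z_i) = per A`. [folklore] -/
theorem coeff_prod_colForms_eq_permanent (A : Matrix ι ι R) :
    MvPolynomial.coeff (∑ i : ι, Finsupp.single i 1)
      (∏ j : ι, ∑ i : ι, C (A i j) * X i : MvPolynomial ι R) = A.permanent := by
  rw [← Matrix.permanent_transpose]
  exact coeff_prod_rowForms_eq_permanent A.transpose

/-- `Fin n` / `ℝ` specialisation of `coeff_prod_rowForms_eq_permanent`, in the exact form
consumed by the `ValiantsHypothesis` tree (Gurvits' proof of the van der Waerden bound):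
`coeff_{z_0 ⋯ z_{n-1}} (∏_i ∑_j A i j · z_j) = per A` for every real `n × n` matrix `A`.
[folklore] -/
theorem coeff_prod_rowForms_eq_permanent_fin :
    ∀ (n : ℕ) (A : Matrix (Fin n) (Fin n) ℝ),
      MvPolynomial.coeff (∑ j : Fin n, Finsupp.single j 1)
          (∏ i : Fin n, ∑ j : Fin n, MvPolynomial.C (A i j) * MvPolynomial.X j :
            MvPolynomial (Fin n) ℝ) = A.permanent :=
  fun _ A => coeff_prod_rowForms_eq_permanent A

end Literature.Combinatorics.Enumerative
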